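import Literature.AlgebraicTopology.SingularHomology.PinchDiscs
import Mathlib.Topology.Homotopy.LocallyContractible
import Mathlib.Topology.CompactOpen
import Mathlib.Topology.Homeomorph.Lemmas
import Literature.AlgebraicTopology.Homotopy.NeighbourhoodRetract
import HarnessLib

/-!
# Pinching finitely many points of a manifold, II: contractible wedges, local contractibility

Sequel to `PinchDiscs`. For a quotient map `q : N → K` from a Hausdorff space charted on a real
normed space `E`, injective except on a finite set `F` (`q a = q b`, `a ≠ b` forces `a, b ∈ F`),
and a disc system `D` around `F`:

* `contractibleSpace_image_discsOver` — **the pinched wedge `q(discsOver q D y)` over a point `y`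
  of `q(F)` is contractible**: the radial contractions of the discs over `y` fix the centres (the
  only points identified by `q`), so they descend to the wedge; continuity of the descended
  homotopy because `q` restricted to the saturated open set of discs is a quotient map and `I` is
  locally compact (Mathlib `IsQuotientMap.continuous_lift_prod_right`);
* `exists_nullhomotopic_of_isOpen` — local contractibility (Mathlib's classical
  `LocallyContractibleSpace`: null-homotopic inclusions) is a local property;
* `locallyContractibleSpace_of_pinch` — **the pinched space `K` is locally contractible**: pinched
  points have the contractible wedges as small neighbourhoods; off `q(F)`, `K` is homeomorphic to
  the open submanifold `N ∖ F` (manifolds are locally contractible, the tree's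
  `locallyContractibleSpace_of_chartedSpace`, Hatcher Cor. A.9).

Everything is proved; no named facts.

## References

* [HatcherAT2002] A. Hatcher, Algebraic Topology, CUP 2002, Ch. 0, App. A (Prop. A.4, Cor. A.9).
-/

noncomputable section

open Set Filter Topology unitInterval

namespace Literature.AlgebraicTopology.SingularHomology

namespace Pinch

/-! ### The pinched wedges are contractible -/

section Contract

variable {E : Type*} [NormedAddCommGroup E]
  {N : Type*} [TopologicalSpace N] [ChartedSpace E N]
  {K : Type*} {q : N → K} {F : Set N}
  (hinj : ∀ ⦃a b : N⦄, q a = q b → a ≠ b → a ∈ F ∧ b ∈ F) (D : DiscSystem E F) (y₀ : K)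

/-- The centre of the disc over `y₀` containing a point of `q⁻¹(q(discsOver y₀))`. [folklore] -/
def ctr (x : ↥(q ⁻¹' (q '' discsOver q D y₀))) : N :=
  (mem_discsOver_iff.1 ((preimage_image_discsOver hinj D y₀).le x.2)).choose

/-- The chosen centre lies in `F`, over `y₀`, and its disc contains the point. [folklore] -/
theorem ctr_spec (x : ↥(q ⁻¹' (q '' discsOver q D y₀))) :
    ctr hinj D y₀ x ∈ F ∧ q (ctr hinj D y₀ x) = y₀ ∧ x.1 ∈ D.disc (ctr hinj D y₀ x) := by
  obtain ⟨h1, h2, h3⟩ := (mem_discsOver_iff.1 ((preimage_image_discsOver hinj D y₀).le x.2)).choose_spec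
  exact ⟨h1, h2, h3⟩

/-- The centre is locally constant: it is `n` on the disc of `n`. [folklore] -/
theorem ctr_eq_of_mem {n : N} (hn : n ∈ F) (x : ↥(q ⁻¹' (q '' discsOver q D y₀)))
    (hx : x.1 ∈ D.disc n) : ctr hinj D y₀ x = n :=
  D.eq_of_mem_disc_of_mem_disc (ctr_spec hinj D y₀ x).1 hn (ctr_spec hinj D y₀ x).2.2 hx

variable [NormedSpace ℝ E]

/-- The radial contraction pushed to the wedge, on the saturated preimage. [folklore] -/
def prehomotopy (p : I × ↥(q ⁻¹' (q '' discsOver q D y₀))) : ↥(q '' discsOver q D y₀) :=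
  ⟨q (radialPoint (E := E) (ctr hinj D y₀ p.2) p.1 p.2.1), by
    obtain ⟨hF, hqn, hx⟩ := ctr_spec hinj D y₀ p.2
    exact ⟨_, (disc_subset_discsOver q D hF).trans (by rw [hqn])
      (radialPoint_mem_chartDisc (D.good hF) hx p.1), rfl⟩⟩

/-- On the disc of `n ∈ F` the pushed contraction is `q ∘ radialPoint n`. [folklore] -/
theorem prehomotopy_apply_of_mem {n : N} (hn : n ∈ F) (t : I) (x : ↥(q ⁻¹' (q '' discsOver q D y₀)))
    (hx : x.1 ∈ D.disc n) : (prehomotopy hinj D y₀ (t, x)).1 = q (radialPoint (E := E) n t x.1) := by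
  change q (radialPoint (E := E) (ctr hinj D y₀ x) t x.1) = _
  rw [ctr_eq_of_mem hinj D y₀ hn x hx]

variable [TopologicalSpace K]

/-- The pushed radial contraction is continuous (it is given by the radial contraction of ONE
disc near each point). [folklore] -/
theorem continuous_prehomotopy (hqc : Continuous q) : Continuous (prehomotopy (E := E) hinj D y₀) := by
  refine Continuous.subtype_mk ?_ _
  refine continuous_iff_continuousAt.2 fun p₀ ↦ ?_
  obtain ⟨hF, hqn, hx₀⟩ := ctr_spec hinj D y₀ p₀.2
  set n := ctr hinj D y₀ p₀.2 with hndef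
  -- near `p₀` the map is `q ∘ radialPoint n`
  have hO : IsOpen {p : I × ↥(q ⁻¹' (q '' discsOver q D y₀)) | p.2.1 ∈ D.disc n} :=
    (isOpen_chartDisc n _).preimage (continuous_subtype_val.comp continuous_snd)
  have hev : (fun p : I × ↥(q ⁻¹' (q '' discsOver q D y₀)) ↦
      q (radialPoint (E := E) (ctr hinj D y₀ p.2) p.1 p.2.1)) =ᶠ[𝓝 p₀]
      fun p ↦ q (radialPoint (E := E) n p.1 p.2.1) := by
    filter_upwards [hO.mem_nhds hx₀] with p hp
    exact prehomotopy_apply_of_mem hinj D y₀ hF p.1 p.2 hp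
  refine ContinuousAt.congr ?_ hev.symm
  have hcont : ContinuousOn (fun p : I × ↥(q ⁻¹' (q '' discsOver q D y₀)) ↦
      radialPoint (E := E) n p.1 p.2.1) {p | p.2.1 ∈ D.disc n} :=
    (continuousOn_radialPoint (E := E) (D.good hF)).comp
      (continuous_fst.prodMk (continuous_subtype_val.comp continuous_snd)).continuousOn
      fun p hp ↦ ⟨mem_univ _, hp⟩
  exact hqc.continuousAt.comp (hcont.continuousAt (hO.mem_nhds hx₀))

omit [TopologicalSpace K] in
/-- The pushed contraction is constant on the fibres of `q`. [folklore] -/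
theorem prehomotopy_eq (t : I) (x x' : ↥(q ⁻¹' (q '' discsOver q D y₀))) (h : q x.1 = q x'.1) :
    prehomotopy (E := E) hinj D y₀ (t, x) = prehomotopy hinj D y₀ (t, x') := by
  by_cases hxx : x.1 = x'.1
  · rw [Subtype.ext hxx]
  · obtain ⟨hxF, hx'F⟩ := hinj h hxx
    -- both are points of `F`, hence centres, fixed by the contraction
    have e1 : (prehomotopy (E := E) hinj D y₀ (t, x)).1 = q x.1 := by
      rw [prehomotopy_apply_of_mem hinj D y₀ hxF t x (D.mem_disc_self hxF), radialPoint_self]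
    have e2 : (prehomotopy (E := E) hinj D y₀ (t, x')).1 = q x'.1 := by
      rw [prehomotopy_apply_of_mem hinj D y₀ hx'F t x' (D.mem_disc_self hx'F), radialPoint_self]
    exact Subtype.ext (e1.trans (h.trans e2.symm))

/-- **The pinched wedge over a point of `q(F)` is contractible**: the radial contractions of the
discs over `y₀` descend to `q(discsOver y₀)` (they fix the centres, the only identified points),
continuously because `q` is a quotient map and `I` is locally compact. [folklore] -/
theorem contractibleSpace_image_discsOver
    (hinj : ∀ ⦃a b : N⦄, q a = q b → a ≠ b → a ∈ F ∧ b ∈ F) (hq : IsQuotientMap q) {n₀ : N} (hn₀ : n₀ ∈ F) (hy₀ : q n₀ = y₀) :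
    ContractibleSpace ↥(q '' discsOver q D y₀) := by
  set W := q '' discsOver q D y₀ with hW
  have hqW : IsQuotientMap (W.restrictPreimage q) :=
    hq.restrictPreimage_isOpen (isOpen_image_discsOver hq hinj D y₀)
  -- a section of `q` over `W`
  obtain ⟨sec, hsec⟩ := hqW.surjective.hasRightInverse
  let H : I × ↥W → ↥W := fun p ↦ prehomotopy (E := E) hinj D y₀ (p.1, sec p.2)
  have hHq : ∀ (t : I) (x : ↥(q ⁻¹' W)), H (t, W.restrictPreimage q x) = prehomotopy hinj D y₀ (t, x) := by
    intro t x
    refine prehomotopy_eq hinj D y₀ t _ _ ?_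
    have := congrArg Subtype.val (hsec (W.restrictPreimage q x))
    exact this
  have hHc : Continuous H := by
    refine hqW.continuous_lift_prod_right (g := H) ?_
    have : (fun p : I × ↥(q ⁻¹' W) ↦ H (p.1, W.restrictPreimage q p.2)) =
        fun p ↦ prehomotopy (E := E) hinj D y₀ (p.1, p.2) := funext fun p ↦ hHq p.1 p.2
    rw [this]
    exact continuous_prehomotopy hinj D y₀ hq.continuous
  have hy₀W : y₀ ∈ W := ⟨n₀, (disc_subset_discsOver q D hn₀).trans (by rw [hy₀]) (D.mem_disc_self hn₀), hy₀⟩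
  have h0 : ∀ w, H (0, w) = w := by
    intro w
    obtain ⟨x, rfl⟩ := hqW.surjective w
    rw [hHq]
    obtain ⟨hF, hqn, hx⟩ := ctr_spec hinj D y₀ x
    exact Subtype.ext ((prehomotopy_apply_of_mem hinj D y₀ hF 0 x hx).trans
      (congrArg q (radialPoint_zero hx)))
  have h1 : ∀ w, H (1, w) = ⟨y₀, hy₀W⟩ := by
    intro w
    obtain ⟨x, rfl⟩ := hqW.surjective w
    rw [hHq]
    obtain ⟨hF, hqn, hx⟩ := ctr_spec hinj D y₀ x
    exact Subtype.ext ((prehomotopy_apply_of_mem hinj D y₀ hF 1 x hx).trans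
      ((congrArg q (radialPoint_one _ x.1)).trans hqn))
  let Hh : ContinuousMap.Homotopy (ContinuousMap.id ↥W) (ContinuousMap.const ↥W ⟨y₀, hy₀W⟩) :=
    { toFun := H
      continuous_toFun := hHc
      map_zero_left := h0
      map_one_left := h1 }
  exact (contractible_iff_id_nullhomotopic ↥W).2 ⟨⟨y₀, hy₀W⟩, ⟨Hh⟩⟩

end Contract

/-! ### Local contractibility of the pinched space -/

section LocallyContractible

variable {K : Type*} [TopologicalSpace K]

/-- **Local contractibility is local**: if `y` lies in an open `O ⊆ K` with `↥O` locally
contractible, then every neighbourhood of `y` in `K` contains a neighbourhood `V` of `y` whose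
inclusion is null-homotopic. [folklore] -/
theorem exists_nullhomotopic_of_isOpen {O : Set K} (hO : IsOpen O) (hLC : LocallyContractibleSpace ↥O)
    {y : K} (hy : y ∈ O) {U : Set K} (hU : U ∈ 𝓝 y) :
    ∃ (V : Set K) (hVU : V ⊆ U), V ∈ 𝓝 y ∧ (ContinuousMap.inclusion hVU).Nullhomotopic := by
  have hemb := hO.isOpenEmbedding_subtypeVal
  -- the neighbourhood `U ∩ O` read in `↥O`
  set U' : Set ↥O := Subtype.val ⁻¹' (U ∩ O) with hU'
  have hU'n : U' ∈ 𝓝 (⟨y, hy⟩ : ↥O) :=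
    continuous_subtype_val.continuousAt.preimage_mem_nhds (Filter.inter_mem hU (hO.mem_nhds hy))
  obtain ⟨V', hV'U', hV'n, hnull⟩ := hLC ⟨y, hy⟩ U' hU'n
  refine ⟨Subtype.val '' V', ?_, ?_, ?_⟩
  · rintro _ ⟨v, hv, rfl⟩
    exact (hV'U' hv).1
  · have := (hemb.image_mem_nhds (x := ⟨y, hy⟩) (s := V')).2 hV'n
    exact this
  · -- `↥(val '' V') → ↥V'` and `↥U' → ↥U`, conjugating the null-homotopic inclusion
    have hmemV : ∀ v : ↥(Subtype.val '' V'), (⟨v.1, ?_⟩ : ↥O) ∈ V' := ?_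
    rotate_left
    · obtain ⟨w, -, hw⟩ := v.2
      exact hw ▸ w.2
    · intro v
      obtain ⟨w, hw, hwv⟩ := v.2
      have : (⟨v.1, hwv ▸ w.2⟩ : ↥O) = w := Subtype.ext hwv.symm
      rw [this]
      exact hw
    let φ : C(↥(Subtype.val '' V'), ↥V') :=
      ⟨fun v ↦ ⟨⟨v.1, _⟩, hmemV v⟩, by
        refine Continuous.subtype_mk (Continuous.subtype_mk continuous_subtype_val _) _⟩
    let ψ : C(↥U', ↥U) := ⟨fun u ↦ ⟨u.1.1, u.2.1⟩,
      (continuous_subtype_val.comp continuous_subtype_val).subtype_mk _⟩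
    have heq : ContinuousMap.inclusion (show Subtype.val '' V' ⊆ U from fun _ ⟨v, hv, h⟩ ↦ h ▸ (hV'U' hv).1) =
        ψ.comp ((ContinuousMap.inclusion hV'U').comp φ) := by
      ext v
      rfl
    rw [heq]
    exact (hnull.comp_left φ).comp_right ψ

variable (E : Type*) [NormedAddCommGroup E] [NormedSpace ℝ E]
  {N : Type*} [TopologicalSpace N] [ChartedSpace E N] {q : N → K} {F : Set N}

include E in
/-- **The pinched space is locally contractible.** Let `q : N → K` be a quotient map from a space
charted on a real normed space, injective except on a finite set `F` (`q a = q b`, `a ≠ b` forces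
`a, b ∈ F`), `N` Hausdorff. Then `K` is locally contractible: at a point of `q(F)` the pinched
wedges `q(discsOver)` of small chart discs are contractible neighbourhoods
(`contractibleSpace_image_discsOver`); off `q(F)`, `K` is locally homeomorphic to the manifold
`N ∖ F`. [folklore] -/
theorem locallyContractibleSpace_of_pinch [T2Space N] (hq : IsQuotientMap q) (hF : F.Finite)
    (hinj : ∀ ⦃a b : N⦄, q a = q b → a ≠ b → a ∈ F ∧ b ∈ F) : LocallyContractibleSpace K := by
  classical
  intro y U hU
  by_cases hy : y ∈ q '' F
  · -- a pinched point: contractible wedge neighbourhoods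
    obtain ⟨n₀, hn₀, hqn₀⟩ := hy
    set O := interior U with hOdef
    have hOU : O ⊆ U := interior_subset
    have hyO : y ∈ O := mem_interior_iff_mem_nhds.2 hU
    obtain ⟨D, hD⟩ := exists_discSystem (E := E) hF (fun n ↦ if q n = y then q ⁻¹' O else univ)
      (fun n hn ↦ by
        by_cases h : q n = y
        · rw [if_pos h]
          exact (isOpen_interior.preimage hq.continuous).mem_nhds (by rw [mem_preimage, h]; exact hyO)
        · rw [if_neg h]; exact univ_mem)
    have hVO : q '' discsOver q D y ⊆ O := by
      rintro _ ⟨x, hx, rfl⟩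
      obtain ⟨n, hn, hqn, hxn⟩ := mem_discsOver_iff.1 hx
      have := hD hn hxn
      rw [if_pos hqn] at this
      exact this
    haveI := contractibleSpace_image_discsOver D y hinj hq hn₀ hqn₀
    refine ⟨q '' discsOver q D y, hVO.trans hOU, (isOpen_image_discsOver hq hinj D y).mem_nhds
      ⟨n₀, (disc_subset_discsOver q D hn₀).trans (by rw [hqn₀]) (D.mem_disc_self hn₀), hqn₀⟩, ?_⟩
    have h := (id_nullhomotopic ↥(q '' discsOver q D y)).comp_right
      (ContinuousMap.inclusion (hVO.trans hOU))
    rwa [ContinuousMap.comp_id] at h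
  · -- a smooth point: `K` is a manifold near `y`
    set K₀ : Set K := q '' Fᶜ with hK₀
    have hsat : q ⁻¹' K₀ = Fᶜ := by
      refine Subset.antisymm (fun x hx ↦ ?_) (subset_preimage_image q _)
      obtain ⟨a, ha, hax⟩ := hx
      by_contra hxF
      by_cases hax' : a = x
      · exact ha (hax' ▸ not_notMem.1 hxF)
      · exact ha (hinj hax hax').1
    have hK₀o : IsOpen K₀ := by
      rw [← hq.isOpen_preimage, hsat]
      exact hF.isClosed.isOpen_compl
    have hyK₀ : y ∈ K₀ := by
      obtain ⟨x, rfl⟩ := hq.surjective y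
      exact ⟨x, fun hxF ↦ hy ⟨x, hxF, rfl⟩, rfl⟩
    -- `q` restricts to a homeomorphism `↥(q⁻¹K₀) ≃ₜ ↥K₀`
    have hq₀ : IsQuotientMap (K₀.restrictPreimage q) := hq.restrictPreimage_isOpen hK₀o
    have hinj₀ : Function.Injective (K₀.restrictPreimage q) := by
      intro a b hab
      have hab' : q a.1 = q b.1 := congrArg Subtype.val hab
      by_contra hne
      have ha : a.1 ∈ Fᶜ := hsat.le a.2
      exact ha (hinj hab' (fun h ↦ hne (Subtype.ext h))).1
    have hhom : IsHomeomorph (K₀.restrictPreimage q) :=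
      isHomeomorph_iff_isQuotientMap_injective.2 ⟨hq₀, hinj₀⟩
    -- `↥(q⁻¹K₀)` is an open submanifold, hence locally contractible
    let W : TopologicalSpace.Opens N := ⟨q ⁻¹' K₀, hK₀o.preimage hq.continuous⟩
    have hLCW : LocallyContractibleSpace ↥W :=
      Literature.AlgebraicTopology.Homotopy.locallyContractibleSpace_of_chartedSpace E
    have hLC₀ : LocallyContractibleSpace ↥K₀ :=
      Literature.AlgebraicTopology.Homotopy.locallyContractibleSpace_of_homeomorph
        (hhom.homeomorph (K₀.restrictPreimage q)) hLCW
    exact exists_nullhomotopic_of_isOpen hK₀o hLC₀ hyK₀ hU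

end LocallyContractible

end Pinch

end Literature.AlgebraicTopology.SingularHomology

end
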